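import Summits.Langlands.Langlands.Theorems.SqrtFiveQuarticCoversBoxQuartic
import Summits.Langlands.Langlands.Theorems.SqrtFiveQuarticCoversBoxQuarticStubFiveBorel
import Summits.Langlands.Langlands.Theorems.SqrtFiveQuarticCoversBoxQuarticStubBorelFiveLocusModular
import Summits.Langlands.Langlands.Theorems.SqrtFiveQuarticCoversReductionToRefinedLocusStubBoxThreeSeven

/-!
# Skeleton of the crux `BoxQuartic` (stmt-Langlands-17836), line `birth` — rev 2 (2026-08-30):
# the three registered stubs INTEGRATED; the residual sorries are the five printed theorems themselves

Route `SqrtFiveQuarticCovers`; crux = Box 2022, Thm. 1.1 verbatim (every `E / 𝓞 K`, `Δ ≠ 0`, over a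
totally real QUARTIC `K` with `√5 ∉ K` is modular in the trace-only sense of the summit's cone, written
out).  Rev 1 (planner-skel-stmt-Langlands-17836, sha 2125c8a6bf1b3c71) cut Box's proof at its three
printed joints: `stub_threeSevenImages` (Thm. 1.3 (i),(iii), quartic), `stub_fiveBorel` (Thm. 1.3 (ii)
= Thorne 2016 Thm. 7.6), `stub_borelFiveLocusModular` (Thm. 1.5 with 1.4), each "closable from a
named fact".  All three are now THEOREMS OF THE TREE MODULO NAMED FACTS (kernel-checked, landed):

* `stub_threeSevenImages` ⇐ `FLS2015_theorem3 ∧ FLS2015_theorem4 ∧ Kalyanswamy2018_theorem1_2` —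
  `Summit.Langlands.Langlands.Theorems.SqrtFiveQuarticCovers.stub_boxThreeSeven_of_liftingTheorems`
  (file `Theorems/SqrtFiveQuarticCoversReductionToRefinedLocusStubBoxThreeSeven.lean`, identical statement =
  the 3/7-half of the sibling crux `ReductionToRefinedLocus`; FLS Prop. 9.1 (a),(c) and all
  `GL₂(𝔽₃)`/`GL₂(𝔽₇)` group theory PROVED in the Literature) — see `threeSevenImages_of_stubs` below;
* `stub_fiveBorel` ⇐ `FLS2015_theorem3 ∧ (T)` (Thorne 2016 Thm. 7.5 for `ρ_{E,p}`) —
  `Summit.Langlands.Langlands.Theorems.stub_fiveBorel_of_liftingTheorems` (p794101) — `fiveBorel_of_stubs`;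
* `stub_borelFiveLocusModular` ⇐ `Box2022_theorem1_5_modular` —
  `Summit.Langlands.Langlands.Theorems.stub_borelFiveLocusModular_of_Box2022_theorem1_5_modular`
  (p793924) — `borelFiveLocusModular_of_stubs`;
* the whole crux ⇐ the five facts: `Summit.Langlands.Langlands.Theorems.BoxQuartic_of_liftingTheorems`
  (p794454, through the Literature deduction `Box2022_theorem1_1_of_liftingTheorems`, p794209).

No unconditional (by-name) close of the rev-1 stubs is possible in the tree: each IS a printed deep
theorem (Taylor–Wiles–Kisin patching; quartic points by Chabauty / Mordell–Weil sieves in Magma) with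
no carrier for its proof.  Hence this rev 2 moves the sorries to where the mathematics actually stops:
the REGISTERED STUBS are now the five printed inputs, each LITERALLY a named fact of the Literature
(its discharge `X_holds` closes the stub by `theorem stub_X : X := X_holds`):

1. `stub_FLS2015_theorem3` : `Literature.NumberTheory.Automorphic.FLS2015_theorem3` — Freitas–Le Hung–
   Siksek 2015, Thm. 3 (`p = 3, 5`: big image over `K(ζ_p)` ⇒ modular). XL (R = T).
2. `stub_FLS2015_theorem4` : `…FLS2015_theorem4` — ibid., Thm. 4 (`p = 7`). XL.
3. `stub_Kalyanswamy2018_theorem1_2` : `…Kalyanswamy2018_theorem1_2` — Kalyanswamy 2018, Thm. 1.2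
   (residually dihedral at `7`). XL.
4. `stub_Thorne2016_theorem7_5` : (T) = Thorne 2016, Thm. 7.5 (= Thm. 1.2) for `ρ_{E,p}`, WRITTEN OUT —
   verbatim the body of the named fact `…Thorne2016_theorem7_5_ellipticCurve`
   (`Literature/NumberTheory/Automorphic/ResiduallyDihedralAutomorphyLifting.lean`, a module with no hub
   build yet, hence not importable) and the binder `hT` of `Box2022_theorem1_3_of_fourLiftingTheorems`. XL.
5. `stub_Box2022_theorem1_5_modular` : `…Box2022_theorem1_5_modular` — Box 2022, Thm. 1.5 with 1.4
   (all totally real quartic points of `X₀(105)`, `X(s3,b5,b7)`, `X(b3,b5,e7)`, `X(s3,b5,e7)`). XL.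

Composition `BoxQuartic_of` (no `sorry`; hypotheses = the five stub statements BY NAME, `_Goal.stub_* :=
type_of% @stub_*`; conclusion = the route decl by name) is `BoxQuartic_of_liftingTheorems`.  Sorries:
exactly five, one per `stub_*`.  The three rev-1 stub STATEMENTS (registered signatures verbatim) are
re-derived below from the new stubs (`*_of_stubs`, no sorry), so nothing of rev 1 is lost.

Disproof used: none on file for this crux (`ledger crux ls stmt-Langlands-17836`: no Disproof.lean, no
Negative lemmas).  Dead lines: none.  Honest label: CONDITIONAL throughout; nothing here proves a lifting
theorem or modularity of a new curve; closing this crux outright = discharging the five facts.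
-/

set_option linter.dupNamespace false
set_option linter.unusedVariables false

open scoped Matrix NumberField MatrixGroups

namespace Summit.Langlands.Langlands.Cruxes.BoxQuartic.Birth

/-! ## Registered stubs (rev 2): the five printed theorems -/

/-- STUB 1 — **Freitas–Le Hung–Siksek 2015, Thm. 3** (named fact `FLS2015_theorem3`, Invent. Math. 201,
Thm. 3: `p ∈ {3,5}`, `ρ̄_{E,p}(G_{K(ζ_p)})` absolutely irreducible ⇒ `E` modular; XL, Taylor–Wiles–Kisin
patching).  Used by Box's Thm. 1.3 (i) and, through Thorne's Thm. 7.6, (ii).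
[cite: FreitasLeHungSiksek2015, Thm. 3] -/
theorem stub_FLS2015_theorem3 : Literature.NumberTheory.Automorphic.FLS2015_theorem3 := by
  sorry

/-- STUB 2 — **Freitas–Le Hung–Siksek 2015, Thm. 4** (named fact `FLS2015_theorem4`: the `p = 7`
lifting theorem; XL).  Used by Box's Thm. 1.3 (iii). [cite: FreitasLeHungSiksek2015, Thm. 4] -/
theorem stub_FLS2015_theorem4 : Literature.NumberTheory.Automorphic.FLS2015_theorem4 := by
  sorry

/-- STUB 3 — **Kalyanswamy 2018, Thm. 1.2** (named fact `Kalyanswamy2018_theorem1_2`: automorphy of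
residually dihedral `ρ_{E,7}` when `ζ₇ + ζ₇⁻¹ ∉ K`; XL).  Used by Box's Thm. 1.3 (iii).
[cite: Kalyanswamy2018, Thm. 1.2] -/
theorem stub_Kalyanswamy2018_theorem1_2 : Literature.NumberTheory.Automorphic.Kalyanswamy2018_theorem1_2 := by
  sorry

/-- STUB 4 — **Thorne 2016, Thm. 7.5 (= Thm. 1.2) for `ρ_{E,p}`** (hypothesis (T), written out; verbatim
the body of the named fact `Literature.NumberTheory.Automorphic.Thorne2016_theorem7_5_ellipticCurve` and
the binder `hT` of `Box2022_theorem1_3_of_fourLiftingTheorems` / `Thorne2016_theorem7_6_of_dihedralLifting`: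
for `F` totally real, `p ≠ 2`, `E / 𝓞 F` with `Δ ≠ 0`, an absolutely irreducible framing `ρ̄` of `E[p]`
which over a model `L` of `F(ζ_p)` becomes a sum of two distinct characters, with the quadratic subfield
of `F(ζ_p)/F` totally real, `E` is automorphic of weight zero; XL, TWK patching without the Taylor–Wiles
hypothesis).  Used by Box's Thm. 1.3 (ii) = Thorne's Thm. 7.6 — the only joint where `√5 ∉ K` enters.
[cite: Thorne2016, Thm. 7.5 (= Thm. 1.2), proof of Thm. 7.6] -/
theorem stub_Thorne2016_theorem7_5 :
    ∀ (F : Type) [Field F] [NumberField F] [NumberField.IsTotallyReal F] (p : ℕ) [Fact p.Prime], p ≠ 2 →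
      ∀ (E : WeierstrassCurve (NumberField.RingOfIntegers F)), E.Δ ≠ 0 →
        ∀ ρ : Literature.NumberTheory.GaloisRepresentations.ModPGaloisRep F (ZMod p) 2,
          (E.baseChange F).IsTorsionGaloisRep p ρ →
          Literature.NumberTheory.GaloisRepresentations.FramedRep.IsAbsolutelyIrreducible ρ →
          ∀ (L : Type) [Field L] [Algebra F L] [IsCyclotomicExtension {p} F L],
            (∃ (k : Type) (_ : Field k) (f : ZMod p →+* k) (Q : GL (Fin 2) k),
                (∀ τ : Field.absoluteGaloisGroup L,
                  Q * Matrix.GeneralLinearGroup.map f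
                      (Literature.NumberTheory.GaloisRepresentations.FramedGaloisRep.restrictField L ρ τ) * Q⁻¹ ∈
                    Literature.NumberTheory.GaloisRepresentations.Serre1972.diagonalSubgroup k) ∧
                ∃ τ : Field.absoluteGaloisGroup L,
                  ((Q * Matrix.GeneralLinearGroup.map f
                      (Literature.NumberTheory.GaloisRepresentations.FramedGaloisRep.restrictField L ρ τ) *
                      Q⁻¹ : GL (Fin 2) k) : Matrix (Fin 2) (Fin 2) k) 0 0 ≠
                    ((Q * Matrix.GeneralLinearGroup.map f
                      (Literature.NumberTheory.GaloisRepresentations.FramedGaloisRep.restrictField L ρ τ) *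
                      Q⁻¹ : GL (Fin 2) k) : Matrix (Fin 2) (Fin 2) k) 1 1) →
            (∃ (M : Type) (_ : Field M) (_ : Algebra F M),
                Module.finrank F M = 2 ∧ NumberField.IsTotallyReal M ∧ Nonempty (M →ₐ[F] L)) →
            Literature.NumberTheory.Automorphic.IsAutomorphicOfWeightZero E := by
  sorry

/-- STUB 5 — **Box 2022, Thm. 1.5 with Thm. 1.4 (Ribet)** (named fact `Box2022_theorem1_5_modular`: over
ANY totally real quartic `K`, an `E` (`Δ ≠ 0`) with mod-`3` image in `B(3)`/`C_s⁺(3)`, mod-`5` image in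
`B(5)` and mod-`7` image in `B(7)`/`G(e7)` is automorphic of weight zero — Box §§3–6, the quartic points
of the four `b5`-curves; XL).  The load-bearing input; shared with the sibling crux `BoxBorelFive`.
[cite: Box2022, Thm. 1.5, Thm. 1.4, §1.1] -/
theorem stub_Box2022_theorem1_5_modular :
    Literature.NumberTheory.Automorphic.Box2022_theorem1_5_modular := by
  sorry

/-! ## Stub statements by name -/

namespace _Goal

/-- The statement of `stub_FLS2015_theorem3` (literally its type). [folklore] -/
def stub_FLS2015_theorem3 : Prop :=
  type_of% @Summit.Langlands.Langlands.Cruxes.BoxQuartic.Birth.stub_FLS2015_theorem3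

/-- The statement of `stub_FLS2015_theorem4` (literally its type). [folklore] -/
def stub_FLS2015_theorem4 : Prop :=
  type_of% @Summit.Langlands.Langlands.Cruxes.BoxQuartic.Birth.stub_FLS2015_theorem4

/-- The statement of `stub_Kalyanswamy2018_theorem1_2` (literally its type). [folklore] -/
def stub_Kalyanswamy2018_theorem1_2 : Prop :=
  type_of% @Summit.Langlands.Langlands.Cruxes.BoxQuartic.Birth.stub_Kalyanswamy2018_theorem1_2

/-- The statement of `stub_Thorne2016_theorem7_5` (literally its type). [folklore] -/
def stub_Thorne2016_theorem7_5 : Prop :=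
  type_of% @Summit.Langlands.Langlands.Cruxes.BoxQuartic.Birth.stub_Thorne2016_theorem7_5

/-- The statement of `stub_Box2022_theorem1_5_modular` (literally its type). [folklore] -/
def stub_Box2022_theorem1_5_modular : Prop :=
  type_of% @Summit.Langlands.Langlands.Cruxes.BoxQuartic.Birth.stub_Box2022_theorem1_5_modular

end _Goal

/-! ## The rev-1 registered stubs, re-derived from the rev-2 stubs (no `sorry`) -/

/-- Rev-1 stub `stub_threeSevenImages` (registered signature verbatim) from stubs 1–3, by the landed
`SqrtFiveQuarticCovers.stub_boxThreeSeven_of_liftingTheorems`. [cite: Box2022, Thm. 1.3 (i), (iii)] -/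
theorem threeSevenImages_of_stubs (h3 : _Goal.stub_FLS2015_theorem3) (h4 : _Goal.stub_FLS2015_theorem4)
    (hKal : _Goal.stub_Kalyanswamy2018_theorem1_2) :
    ∀ (K : Type) [Field K] [NumberField K], NumberField.IsTotallyReal K → Module.finrank ℚ K = 4 → ∀ E : WeierstrassCurve (NumberField.RingOfIntegers K), E.Δ ≠ 0 → ¬ ((E.baseChange K).HasCM ∨ ∃ (hF : Literature.NumberTheory.Automorphic.isCompact_glFiniteIntegralLevel 2 K) (π : Literature.NumberTheory.Automorphic.CuspidalAutomorphicRepData 2 K hF), π.1.HasWeightZero ∧ ∀ᶠ w : IsDedekindDomain.HeightOneSpectrum (NumberField.RingOfIntegers K) in Filter.cofinite, ∃ α : Multiset ℂ, π.1.HasSatakeParamAt w α ∧ ((Real.sqrt w.residueCard : ℝ) : ℂ) * α.sum = (Literature.NumberTheory.Automorphic.frobTraceAt E w : ℂ)) → (∃ ρ : Literature.NumberTheory.GaloisRepresentations.FramedGaloisRep K (ZMod 3) 2, (∃ e : (E.baseChange K).geomTorsion ((3 : ℕ) : ℤ) ≃+ (Fin 2 → ZMod 3), ∀ (σ : Field.absoluteGaloisGroup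 K) (P : (E.baseChange K).geomTorsion ((3 : ℕ) : ℤ)), e (σ • P) = ((ρ σ : GL (Fin 2) (ZMod 3)) : Matrix (Fin 2) (Fin 2) (ZMod 3)) *ᵥ (e P)) ∧ ((∀ σ : Field.absoluteGaloisGroup K, (((ρ σ : GL (Fin 2) (ZMod 3)) : Matrix (Fin 2) (Fin 2) (ZMod 3)) 1 0 = 0)) ∨ (∀ σ : Field.absoluteGaloisGroup K, (ρ σ : GL (Fin 2) (ZMod 3)) ∈ Subgroup.closure ({(⟨!![1, 0; 0, 2], !![1, 0; 0, 2], by decide, by decide⟩ : GL (Fin 2) (ZMod 3)), (⟨!![0, 1; 1, 0], !![0, 1; 1, 0], by decide, by decide⟩ : GL (Fin 2) (ZMod 3))} : Set (GL (Fin 2) (ZMod 3)))))) ∧ (∃ ρ : Literature.NumberTheory.GaloisRepresentations.FramedGaloisRep K (ZMod 7) 2, (∃ e : (E.baseChange K).geomTorsion ((7 : ℕ) : ℤ) ≃+ (Fin 2 → ZMod 7), ∀ (σ : Field.absoluteGaloisGroup K) (P : (E.baseChange K).geomTorsion ((7 : ℕ) : ℤ)), e (σ • P) = ((ρ σ : GL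 (Fin 2) (ZMod 7)) : Matrix (Fin 2) (Fin 2) (ZMod 7)) *ᵥ (e P)) ∧ ((∀ σ : Field.absoluteGaloisGroup K, (((ρ σ : GL (Fin 2) (ZMod 7)) : Matrix (Fin 2) (Fin 2) (ZMod 7)) 1 0 = 0)) ∨ (∀ σ : Field.absoluteGaloisGroup K, (ρ σ : GL (Fin 2) (ZMod 7)) ∈ Subgroup.closure ({(⟨!![0, 5; 3, 0], !![0, 5; 3, 0], by decide, by decide⟩ : GL (Fin 2) (ZMod 7)), (⟨!![5, 0; 3, 2], !![3, 0; 6, 4], by decide, by decide⟩ : GL (Fin 2) (ZMod 7))} : Set (GL (Fin 2) (ZMod 7)))))) :=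
  Summit.Langlands.Langlands.Theorems.SqrtFiveQuarticCovers.stub_boxThreeSeven_of_liftingTheorems h3 h4 hKal

/-- Rev-1 stub `stub_fiveBorel` (registered signature verbatim) from stubs 1 and 4, by the landed
`stub_fiveBorel_of_liftingTheorems`. [cite: Box2022, Thm. 1.3 (ii)] [cite: Thorne2016, Thm. 7.6] -/
theorem fiveBorel_of_stubs (h3 : _Goal.stub_FLS2015_theorem3) (hT : _Goal.stub_Thorne2016_theorem7_5) :
    ∀ (K : Type) [Field K] [NumberField K], NumberField.IsTotallyReal K → (¬ ∃ r : K, r ^ 2 = 5) → ∀ E : WeierstrassCurve (NumberField.RingOfIntegers K), E.Δ ≠ 0 → ¬ ((E.baseChange K).HasCM ∨ ∃ (hF : Literature.NumberTheory.Automorphic.isCompact_glFiniteIntegralLevel 2 K) (π : Literature.NumberTheory.Automorphic.CuspidalAutomorphicRepData 2 K hF), π.1.HasWeightZero ∧ ∀ᶠ w : IsDedekindDomain.HeightOneSpectrum (NumberField.RingOfIntegers K) in Filter.cofinite, ∃ α : Multiset ℂ, π.1.HasSatakeParamAt w α ∧ ((Real.sqrt w.residueCard : ℝ) : ℂ) *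 α.sum = (Literature.NumberTheory.Automorphic.frobTraceAt E w : ℂ)) → (∃ ρ : Literature.NumberTheory.GaloisRepresentations.FramedGaloisRep K (ZMod 5) 2, (∃ e : (E.baseChange K).geomTorsion ((5 : ℕ) : ℤ) ≃+ (Fin 2 → ZMod 5), ∀ (σ : Field.absoluteGaloisGroup K) (P : (E.baseChange K).geomTorsion ((5 : ℕ) : ℤ)), e (σ • P) = ((ρ σ : GL (Fin 2) (ZMod 5)) : Matrix (Fin 2) (Fin 2) (ZMod 5)) *ᵥ (e P)) ∧ (∀ σ : Field.absoluteGaloisGroup K, (((ρ σ : GL (Fin 2) (ZMod 5)) : Matrix (Fin 2) (Fin 2) (ZMod 5)) 1 0 = 0))) :=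
  Summit.Langlands.Langlands.Theorems.stub_fiveBorel_of_liftingTheorems h3 hT

/-- Rev-1 stub `stub_borelFiveLocusModular` (registered signature verbatim) from stub 5, by the landed
`stub_borelFiveLocusModular_of_Box2022_theorem1_5_modular`. [cite: Box2022, Thm. 1.5, Thm. 1.4] -/
theorem borelFiveLocusModular_of_stubs (h15 : _Goal.stub_Box2022_theorem1_5_modular) :
    ∀ (K : Type) [Field K] [NumberField K], NumberField.IsTotallyReal K → Module.finrank ℚ K = 4 → ∀ E : WeierstrassCurve (NumberField.RingOfIntegers K), E.Δ ≠ 0 → (∃ ρ : Literature.NumberTheory.GaloisRepresentations.FramedGaloisRep K (ZMod 3) 2, (∃ e : (E.baseChange K).geomTorsion ((3 : ℕ) : ℤ) ≃+ (Fin 2 → ZMod 3), ∀ (σ : Field.absoluteGaloisGroup K) (P : (E.baseChange K).geomTorsion ((3 : ℕ) : ℤ)), e (σ • P) = ((ρ σ : GL (Fin 2) (ZMod 3)) : Matrix (Fin 2) (Fin 2) (ZMod 3)) *ᵥ (e P)) ∧ ((∀ σ : Field.absoluteGaloisGroup K, (((ρ σ : GL (Fin 2) (ZMod 3)) : Matrix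 (Fin 2) (Fin 2) (ZMod 3)) 1 0 = 0)) ∨ (∀ σ : Field.absoluteGaloisGroup K, (ρ σ : GL (Fin 2) (ZMod 3)) ∈ Subgroup.closure ({(⟨!![1, 0; 0, 2], !![1, 0; 0, 2], by decide, by decide⟩ : GL (Fin 2) (ZMod 3)), (⟨!![0, 1; 1, 0], !![0, 1; 1, 0], by decide, by decide⟩ : GL (Fin 2) (ZMod 3))} : Set (GL (Fin 2) (ZMod 3)))))) → (∃ ρ : Literature.NumberTheory.GaloisRepresentations.FramedGaloisRep K (ZMod 5) 2, (∃ e : (E.baseChange K).geomTorsion ((5 : ℕ) : ℤ) ≃+ (Fin 2 → ZMod 5), ∀ (σ : Field.absoluteGaloisGroup K) (P : (E.baseChange K).geomTorsion ((5 : ℕ) : ℤ)), e (σ • P) = ((ρ σ : GL (Fin 2) (ZMod 5)) : Matrix (Fin 2) (Fin 2) (ZMod 5)) *ᵥ (e P)) ∧ (∀ σ : Field.absoluteGaloisGroup K, (((ρ σ : GL (Fin 2) (ZMod 5)) : Matrix (Fin 2) (Fin 2) (ZMod 5)) 1 0 = 0))) → (∃ ρ : Literature.NumberTheory.GaloisRepresentations.FramedGaloisRep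 K (ZMod 7) 2, (∃ e : (E.baseChange K).geomTorsion ((7 : ℕ) : ℤ) ≃+ (Fin 2 → ZMod 7), ∀ (σ : Field.absoluteGaloisGroup K) (P : (E.baseChange K).geomTorsion ((7 : ℕ) : ℤ)), e (σ • P) = ((ρ σ : GL (Fin 2) (ZMod 7)) : Matrix (Fin 2) (Fin 2) (ZMod 7)) *ᵥ (e P)) ∧ ((∀ σ : Field.absoluteGaloisGroup K, (((ρ σ : GL (Fin 2) (ZMod 7)) : Matrix (Fin 2) (Fin 2) (ZMod 7)) 1 0 = 0)) ∨ (∀ σ : Field.absoluteGaloisGroup K, (ρ σ : GL (Fin 2) (ZMod 7)) ∈ Subgroup.closure ({(⟨!![0, 5; 3, 0], !![0, 5; 3, 0], by decide, by decide⟩ : GL (Fin 2) (ZMod 7)), (⟨!![5, 0; 3, 2], !![3, 0; 6, 4], by decide, by decide⟩ : GL (Fin 2) (ZMod 7))} : Set (GL (Fin 2) (ZMod 7)))))) → ((E.baseChange K).HasCM ∨ ∃ (hF : Literature.NumberTheory.Automorphic.isCompact_glFiniteIntegralLevel 2 K) (π : Literature.NumberTheory.Automorphic.CuspidalAutomorphicRepData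 2 K hF), π.1.HasWeightZero ∧ ∀ᶠ w : IsDedekindDomain.HeightOneSpectrum (NumberField.RingOfIntegers K) in Filter.cofinite, ∃ α : Multiset ℂ, π.1.HasSatakeParamAt w α ∧ ((Real.sqrt w.residueCard : ℝ) : ℂ) * α.sum = (Literature.NumberTheory.Automorphic.frobTraceAt E w : ℂ)) :=
  Summit.Langlands.Langlands.Theorems.stub_borelFiveLocusModular_of_Box2022_theorem1_5_modular h15

/-! ## Composition (kernel-checked, no `sorry`) -/

/-- **Box 2022, Thm. 1.1 (= the crux `BoxQuartic`) from the five printed theorems** — hypotheses = the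
five stub statements BY NAME; conclusion = the route decl BY NAME; proof = the landed
`Summit.Langlands.Langlands.Theorems.BoxQuartic_of_liftingTheorems` (Box's §1.2 contradiction through
Thm. 1.3 (i)–(iii) and Thm. 1.5, every intermediate step kernel-checked in the Literature).
[cite: Box2022, Thm. 1.1 and its proof] -/
theorem BoxQuartic_of (h3 : _Goal.stub_FLS2015_theorem3) (h4 : _Goal.stub_FLS2015_theorem4)
    (hKal : _Goal.stub_Kalyanswamy2018_theorem1_2) (hT : _Goal.stub_Thorne2016_theorem7_5)
    (h15 : _Goal.stub_Box2022_theorem1_5_modular) :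
    Summit.Langlands.Langlands.Theses.SqrtFiveQuarticCovers.BoxQuartic :=
  Summit.Langlands.Langlands.Theorems.BoxQuartic_of_liftingTheorems h3 h4 hKal hT h15

/-- The rev-1 composition survives verbatim as a theorem about the rev-1 statements: stubs 1–3 of rev 1
(now `*_of_stubs`) give the crux by Box's contradiction. [cite: Box2022, proof of Thm. 1.1 (§1)] -/
theorem BoxQuartic_of_rev1 (h3 : _Goal.stub_FLS2015_theorem3) (h4 : _Goal.stub_FLS2015_theorem4)
    (hKal : _Goal.stub_Kalyanswamy2018_theorem1_2) (hT : _Goal.stub_Thorne2016_theorem7_5)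
    (h15 : _Goal.stub_Box2022_theorem1_5_modular) :
    Summit.Langlands.Langlands.Theses.SqrtFiveQuarticCovers.BoxQuartic := by
  intro K _ _ hK hdeg h5n E hE
  by_contra hne
  obtain ⟨h3s, h7s⟩ := threeSevenImages_of_stubs h3 h4 hKal K hK hdeg E hE hne
  exact hne (borelFiveLocusModular_of_stubs h15 K hK hdeg E hE h3s
    (fiveBorel_of_stubs h3 hT K hK h5n E hE hne) h7s)

/-- By-name sanity check (an `example`, not a declaration): the five stubs feed the composition as they
stand (inherits their `sorry`s; registers nothing). -/
example : Summit.Langlands.Langlands.Theses.SqrtFiveQuarticCovers.BoxQuartic :=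
  BoxQuartic_of stub_FLS2015_theorem3 stub_FLS2015_theorem4 stub_Kalyanswamy2018_theorem1_2
    stub_Thorne2016_theorem7_5 stub_Box2022_theorem1_5_modular

end Summit.Langlands.Langlands.Cruxes.BoxQuartic.Birth
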